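import Summits.ValiantsHypothesis.ValiantsHypothesis.Theorems.DefinabilityGapBlockStep
import HarnessLib

/-!
# DefinabilityGap — the refined cover count (coin domination, block by block)

Route `route-ValiantsHypothesis-DefinabilityGap` (decomp-valiant, lens 5), supporting `KIPlantedHitting`
(stmt-ValiantsHypothesis-23547). Source: decomp-valiant lens-5 g16, NOTE-g16 §3.4 (refined Lemma 3) / §4b S6(ii).

SETTING. Blocks `i : ι` carry cell sets `T i ⊆ Fin m × Fin m` with `|T i| ≤ 2` (for the generator: the cells a block
shares with a fixed host). A pattern choice `π : ι → S_m` COVERS the column set `A` with the blocks of `K` if every `a ∈ A`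
has some `i ∈ K` with `(π i a, a) ∈ T i`. MAIN RESULT `cover_count`: with `c = (m−2)/(m−1)`, `φ(n) = 1 − cⁿ`,
`#{π covering A} ≤ (m!)^{|ι|} · ∏_{a ∈ A} φ(n_a)`, `n_a = Σ_{i∈K} #(T i ∩ column a)` — the covering probability is at most
what independent Bernoulli(`1/(m−1)`) coins, one per shared cell, would give (and those factor over columns). Proof:
induction on `K`, conditioning on the new block's pattern (`card_filter_coord_mul`: fibres of an invariant set) and
`DefinabilityGapBlockStep.block_step`. 0 sorry; VP ≠ VNP untouched.
-/

set_option linter.dupNamespace false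

noncomputable section

open Summit.ValiantsHypothesis.ValiantsHypothesis.Theorems.DefinabilityGapPatternCounts
open Summit.ValiantsHypothesis.ValiantsHypothesis.Theorems.DefinabilityGapBlockStep

namespace Summit.ValiantsHypothesis.ValiantsHypothesis.Theorems.DefinabilityGapCoverCount

variable {m : ℕ}

/-! ## 1. Fibres of a coordinate in a coordinate-invariant set of functions -/

/-- In a set of functions invariant under re-assigning coordinate `b₀`, the fibres of `π ↦ π b₀` are no larger than each
other. [folklore] -/
theorem card_filter_coord_le {ι α : Type*} [DecidableEq ι] [DecidableEq α] (E : Finset (ι → α)) (b₀ : ι)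
    (hE : ∀ π ∈ E, ∀ σ : α, Function.update π b₀ σ ∈ E) (ρ ρ' : α) :
    (E.filter fun π => π b₀ = ρ).card ≤ (E.filter fun π => π b₀ = ρ').card := by
  classical
  refine Finset.card_le_card_of_injOn (fun π => Function.update π b₀ ρ') ?_ ?_
  · intro π hπ
    simp only [Finset.coe_filter, Set.mem_setOf_eq] at hπ ⊢
    exact ⟨hE π hπ.1 ρ', Function.update_self _ _ _⟩
  · intro π hπ π' hπ' h
    simp only [Finset.coe_filter, Set.mem_setOf_eq] at hπ hπ'
    funext i
    by_cases hi : i = b₀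
    · subst hi; rw [hπ.2, hπ'.2]
    · have h' : Function.update π b₀ ρ' i = Function.update π' b₀ ρ' i := congr_fun h i
      rwa [Function.update_of_ne hi, Function.update_of_ne hi] at h'

/-- … hence each fibre has size `|E| / |α|`. [folklore] -/
theorem card_filter_coord_mul {ι α : Type*} [DecidableEq ι] [DecidableEq α] [Fintype α] (E : Finset (ι → α)) (b₀ : ι)
    (hE : ∀ π ∈ E, ∀ σ : α, Function.update π b₀ σ ∈ E) (ρ : α) :
    (E.filter fun π => π b₀ = ρ).card * Fintype.card α = E.card := by
  classical
  have hfib := Finset.card_eq_sum_card_fiberwise (s := E) (t := (Finset.univ : Finset α)) (f := fun π => π b₀)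
    fun _ _ => Finset.mem_univ _
  rw [hfib, Finset.sum_congr rfl fun σ _ =>
    le_antisymm (card_filter_coord_le E b₀ hE σ ρ) (card_filter_coord_le E b₀ hE ρ σ), Finset.sum_const,
    Finset.card_univ, smul_eq_mul, mul_comm]

/-! ## 2. The cover count -/

/-- **Refined cover count.** For blocks with `≤ 2` cells each, the number of pattern choices `π : ι → S_m` whose blocks in
`K` cover every column of `A` is at most `(m!)^{|ι|} · ∏_{a ∈ A} φ(Σ_{i ∈ K} #(T i ∩ column a))`. [this file] -/
theorem cover_count (hm : 3 ≤ m) {ι : Type*} [Fintype ι] [DecidableEq ι] (T : ι → Finset (Fin m × Fin m))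
    (hT : ∀ i, (T i).card ≤ 2) (K : Finset ι) (A : Finset (Fin m)) :
    (((Finset.univ.filter fun π : ι → Equiv.Perm (Fin m) => ∀ a ∈ A, ∃ i ∈ K, (π i a, a) ∈ T i).card : ℕ) : ℝ) ≤
      (Nat.factorial m : ℝ) ^ Fintype.card ι * ∏ a ∈ A, phi m (∑ i ∈ K, colCount (T i) a) := by
  classical
  induction K using Finset.induction_on generalizing A with
  | empty =>
    rcases A.eq_empty_or_nonempty with hA | hA
    · subst hA
      have hall : (Finset.univ.filter fun π : ι → Equiv.Perm (Fin m) =>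
          ∀ a ∈ (∅ : Finset (Fin m)), ∃ i ∈ (∅ : Finset ι), (π i a, a) ∈ T i) = Finset.univ :=
        Finset.filter_true_of_mem fun π _ a ha => absurd ha (Finset.notMem_empty a)
      rw [hall, Finset.card_univ, Fintype.card_fun, Fintype.card_perm, Fintype.card_fin, Finset.prod_empty, mul_one]
      push_cast
      exact le_rfl
    · obtain ⟨a, ha⟩ := hA
      have hnone : (Finset.univ.filter fun π : ι → Equiv.Perm (Fin m) =>
          ∀ a ∈ A, ∃ i ∈ (∅ : Finset ι), (π i a, a) ∈ T i) = ∅ := by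
        rw [Finset.filter_eq_empty_iff]
        intro π _ h
        obtain ⟨i, hi, _⟩ := h a ha
        exact Finset.notMem_empty i hi
      rw [hnone, Finset.card_empty, Nat.cast_zero]
      exact mul_nonneg (pow_nonneg (Nat.cast_nonneg _) _) (Finset.prod_nonneg fun _ _ => phi_nonneg hm _)
  | insert b₀ K' hb₀ ih =>
    set F : ℝ := (Nat.factorial m : ℝ) with hF
    have hF0 : 0 < F := by rw [hF]; exact_mod_cast Nat.factorial_pos m
    set Bad := Finset.univ.filter fun π : ι → Equiv.Perm (Fin m) =>
      ∀ a ∈ A, ∃ i ∈ insert b₀ K', (π i a, a) ∈ T i with hBad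
    -- the residual column set and the residual bad set after conditioning on `π b₀ = ρ`
    set Ares : Equiv.Perm (Fin m) → Finset (Fin m) := fun ρ => A.filter fun a => (ρ a, a) ∉ T b₀ with hAres
    set Bad' : Equiv.Perm (Fin m) → Finset (ι → Equiv.Perm (Fin m)) := fun ρ =>
      Finset.univ.filter fun π : ι → Equiv.Perm (Fin m) => ∀ a ∈ Ares ρ, ∃ i ∈ K', (π i a, a) ∈ T i with hBad'
    have hsub : ∀ ρ, Bad.filter (fun π => π b₀ = ρ) ⊆ (Bad' ρ).filter fun π => π b₀ = ρ := by
      intro ρ π hπ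
      obtain ⟨hπB, hπρ⟩ := Finset.mem_filter.1 hπ
      refine Finset.mem_filter.2 ⟨Finset.mem_filter.2 ⟨Finset.mem_univ _, fun a ha => ?_⟩, hπρ⟩
      obtain ⟨haA, hanot⟩ := Finset.mem_filter.1 ha
      obtain ⟨i, hi, hcell⟩ := (Finset.mem_filter.1 hπB).2 a haA
      rcases Finset.mem_insert.1 hi with rfl | hi'
      · rw [hπρ] at hcell; exact absurd hcell hanot
      · exact ⟨i, hi', hcell⟩
    have hinv : ∀ ρ, ((Bad' ρ).filter fun π => π b₀ = ρ).card * Nat.factorial m = (Bad' ρ).card := by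
      intro ρ
      have h := card_filter_coord_mul (Bad' ρ) b₀ ?_ ρ
      · rwa [Fintype.card_perm, Fintype.card_fin] at h
      · intro π hπ σ
        refine Finset.mem_filter.2 ⟨Finset.mem_univ _, fun a ha => ?_⟩
        obtain ⟨i, hi, hcell⟩ := (Finset.mem_filter.1 hπ).2 a ha
        refine ⟨i, hi, ?_⟩
        have hne : i ≠ b₀ := fun h => hb₀ (h ▸ hi)
        rw [Function.update_of_ne hne]
        exact hcell
    have hfib := Finset.card_eq_sum_card_fiberwise (s := Bad) (t := (Finset.univ : Finset (Equiv.Perm (Fin m))))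
      (f := fun π => π b₀) fun _ _ => Finset.mem_univ _
    -- the chain, in ℝ
    have h1 : (Bad.card : ℝ) * F ≤ ∑ ρ : Equiv.Perm (Fin m), ((Bad' ρ).card : ℝ) := by
      rw [hfib, Nat.cast_sum, Finset.sum_mul]
      refine Finset.sum_le_sum fun ρ _ => ?_
      rw [← hinv ρ, Nat.cast_mul, hF]
      exact mul_le_mul_of_nonneg_right (by exact_mod_cast Finset.card_le_card (hsub ρ)) (Nat.cast_nonneg _)
    have h2 : ∀ ρ : Equiv.Perm (Fin m), ((Bad' ρ).card : ℝ) ≤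
        F ^ Fintype.card ι * ∏ a ∈ A, (if (ρ a, a) ∈ T b₀ then (1 : ℝ) else phi m (∑ i ∈ K', colCount (T i) a)) := by
      intro ρ
      refine (ih (Ares ρ)).trans (le_of_eq ?_)
      rw [hF, hAres, Finset.prod_filter]
      congr 1
      refine Finset.prod_congr rfl fun a _ => ?_
      rw [ite_not]
    have h3 := block_step hm (T b₀) (hT b₀) A fun a => ∑ i ∈ K', colCount (T i) a
    have h4 : (Bad.card : ℝ) * F ≤ F ^ Fintype.card ι * (F * ∏ a ∈ A, phi m (∑ i ∈ insert b₀ K', colCount (T i) a)) := by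
      refine h1.trans ((Finset.sum_le_sum fun ρ _ => h2 ρ).trans ?_)
      rw [← Finset.mul_sum]
      refine mul_le_mul_of_nonneg_left (h3.trans (le_of_eq ?_)) (pow_nonneg hF0.le _)
      rw [hF]
      congr 1
      refine Finset.prod_congr rfl fun a _ => ?_
      rw [Finset.sum_insert hb₀, add_comm]
    have h5 : (Bad.card : ℝ) * F ≤ (F ^ Fintype.card ι * ∏ a ∈ A, phi m (∑ i ∈ insert b₀ K', colCount (T i) a)) * F := by
      rw [mul_assoc, mul_comm (∏ a ∈ A, _) F]; exact h4
    exact le_of_mul_le_mul_right h5 hF0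

end Summit.ValiantsHypothesis.ValiantsHypothesis.Theorems.DefinabilityGapCoverCount
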